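import Mathlib
import HarnessLib
import Literature.Analysis.FluidPDE.DriftHeatLocalComparison
import Literature.Analysis.FluidPDE.LiebermanBarrier
import Literature.Analysis.FluidPDE.KNSSLemma21Proof
import Literature.Analysis.PDE.WeakMaximumPrinciple

/-!
# Route `HalfSpaceWindowDoor`, crux `CirculationCarryingRigidity` (stmt-NavierStokesRegularity-25311) — tool: the weak maximum
# principle on the WHOLE SPACE for BOUNDED subsolutions of a drift–heat inequality (no decay at infinity)

Line `eddy_torque`, time-only class (LEAD ns-hsw-p1 g5).  `le_of_subsolution`: let `q : [s₀,s₁] × E → ℝ` be jointly continuous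
and bounded above, `q(s₀,·) ≤ m`, and suppose that at every point `(t,x)`, `s₀ < t ≤ s₁`, where `q(t,x) > m`, the slice `q(t,·)` is
`C²` near `x`, `q(·,x)` is differentiable at `t`, the drift is bounded `‖b(t,x)‖ ≤ Λ`, and
`∂ₜq + Dq[b] − Δq ≤ 0`.  Then `q ≤ m` on the whole slab.  (Smoothness and the inequality are only required on the superlevel set
`{q > m}` — in the application, the mean azimuthal velocity `Γ/(2πr)` of a closed-hemisphere profile is smooth only off the axis,
where it is positive.)  PROOF (Friedman 1964 Ch. 2 §4 / Tikhonov-class barrier): `ψ(t,x) = e^{K(t−s₀)}(1 + ‖x‖²)`,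
`K = 2Λ + 2 dim E`, is a supersolution (`∂ₜψ + b·∇ψ − Δψ ≥ e^{K(t−s₀)}(K(1+‖x‖²) − 2Λ‖x‖ − 2 dim E) ≥ 0`); for `ε, δ > 0`
the function `q − εψ − δ(t − s₀)` tends to `−∞` at spatial infinity, so attains its maximum over the slab on a compact cylinder;
if that maximum exceeded `m` it would sit at an interior point of `{q > m}` with `t > s₀`, where `∇q = ε∇ψ`, `Δq ≤ εΔψ`,
`∂ₜq ≥ ε∂ₜψ + δ` — contradicting the inequality; let `ε, δ → 0`.  The tree's whole-space principle
`Literature.Analysis.FluidPDE.norm_le_of_inner_timeDeriv_le` (`DriftDiffusionMaxPrinciple`) needs decay at infinity uniform in time,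
which the time-only Type-I class does not have; hence this variant.

Seat ns-hsw-p1 g5 (LEAD of 25311, cell pub-ns-dss).  WHAT THIS IS NOT: not a statement about Navier–Stokes regularity; a linear
parabolic tool; helper `--supports` 25311.
-/

noncomputable section

-- the summit and its single sub-problem share the name (CONVENTIONS §1), as in every Theorems file
set_option linter.dupNamespace false

namespace Summit.NavierStokesRegularity.NavierStokesRegularity.Theorems.HalfSpaceWindowDoorCirculationCarryingRigidityWholeSpaceMaxPrinciple

open Set Function Filter Topology InnerProductSpace Metric
open scoped Laplacian RealInnerProductSpace ContDiff Topology
open Literature.Analysis Literature.Analysis.FluidPDE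


/-! ### The barrier `ψ(t,x) = e^{K(t−s₀)}(1 + ‖x‖²)` -/

/-- Spatial derivative of the barrier slice: `D[e^{c}(1 + ‖·‖²)](x) = e^{c}·2⟪x, ·⟫`. -/
theorem hasFDerivAt_barrier_slice (c : ℝ) (x : (EuclideanSpace ℝ (Fin 3))) :
    HasFDerivAt (fun y : (EuclideanSpace ℝ (Fin 3)) => Real.exp c * (1 + ‖y‖ ^ 2)) (Real.exp c • ((2 : ℝ) • innerSL ℝ x)) x := by
  have h := ((hasFDerivAt_norm_sub_sq (0 : (EuclideanSpace ℝ (Fin 3))) x).const_add 1).const_mul (Real.exp c)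
  simp only [sub_zero] at h
  exact h

/-- The barrier slice is smooth. -/
theorem contDiff_barrier_slice (c : ℝ) : ContDiff ℝ 2 (fun y : (EuclideanSpace ℝ (Fin 3)) => Real.exp c * (1 + ‖y‖ ^ 2)) :=
  contDiff_const.mul (contDiff_const.add (contDiff_norm_sq ℝ))

/-- Laplacian of the barrier slice: `Δ[e^{c}(1 + ‖·‖²)] = 6 e^{c}` on `ℝ³`. -/
theorem laplacian_barrier_slice (c : ℝ) (x : (EuclideanSpace ℝ (Fin 3))) :
    (Δ ((fun y => Real.exp c * (1 + ‖y‖ ^ 2)) : (EuclideanSpace ℝ (Fin 3)) → ℝ)) x = Real.exp c * 6 := by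
  have h1 : ContDiffAt ℝ 2 (fun _ : (EuclideanSpace ℝ (Fin 3)) => (1 : ℝ)) x := contDiffAt_const
  have h2 : ContDiffAt ℝ 2 (fun y : (EuclideanSpace ℝ (Fin 3)) => ‖y‖ ^ 2) x := (contDiff_norm_sq ℝ).contDiffAt
  have h12 : ContDiffAt ℝ 2 ((fun _ : (EuclideanSpace ℝ (Fin 3)) => (1 : ℝ)) + fun y : (EuclideanSpace ℝ (Fin 3)) => ‖y‖ ^ 2) x := h1.add h2
  have e : ((fun y => Real.exp c * (1 + ‖y‖ ^ 2)) : (EuclideanSpace ℝ (Fin 3)) → ℝ) = Real.exp c • ((fun _ : (EuclideanSpace ℝ (Fin 3)) => (1 : ℝ)) + fun y : (EuclideanSpace ℝ (Fin 3)) => ‖y‖ ^ 2) := by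
    funext y; simp [smul_eq_mul]
  rw [e, InnerProductSpace.laplacian_smul (Real.exp c) h12, ContDiffAt.laplacian_add h1 h2]
  have h3 : (Δ ((fun y => ‖y‖ ^ 2) : (EuclideanSpace ℝ (Fin 3)) → ℝ)) x = 2 * (Module.finrank ℝ (EuclideanSpace ℝ (Fin 3)) : ℝ) := by
    have := laplacian_norm_sub_sq (0 : (EuclideanSpace ℝ (Fin 3))) x
    simpa only [sub_zero] using this
  rw [h3]
  simp [InnerProductSpace.laplacian_const, smul_eq_mul]
  norm_num

/-! ### The maximum principle -/

set_option maxHeartbeats 400000 in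
/-- **WEAK MAXIMUM PRINCIPLE ON THE WHOLE SPACE FOR BOUNDED SUBSOLUTIONS (no decay at infinity).**  See the module docstring. -/
theorem le_of_subsolution {q : ℝ → (EuclideanSpace ℝ (Fin 3)) → ℝ} {b : ℝ → (EuclideanSpace ℝ (Fin 3)) → (EuclideanSpace ℝ (Fin 3))} {s₀ s₁ Λ B m : ℝ} (hΛ : 0 ≤ Λ)
    (hcont : ContinuousOn (uncurry q) (Icc s₀ s₁ ×ˢ univ))
    (hB : ∀ t ∈ Icc s₀ s₁, ∀ x, q t x ≤ B)
    (hinit : ∀ x, q s₀ x ≤ m)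
    (hsub : ∀ t ∈ Ioc s₀ s₁, ∀ x, m < q t x →
      ‖b t x‖ ≤ Λ ∧ (∃ U : Set (EuclideanSpace ℝ (Fin 3)), IsOpen U ∧ x ∈ U ∧ ContDiffOn ℝ 2 (q t) U) ∧
      (∃ d : ℝ, HasDerivAt (fun τ => q τ x) d t ∧ d + fderiv ℝ (q t) x (b t x) - (Δ (q t)) x ≤ 0)) :
    ∀ t ∈ Icc s₀ s₁, ∀ x, q t x ≤ m := by
  intro t ht x
  by_contra hlt
  push Not at hlt
  set K : ℝ := 2 * Λ + 6 with hK
  have hK0 : 0 ≤ K := by positivity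
  set ψ : ℝ → (EuclideanSpace ℝ (Fin 3)) → ℝ := fun τ y => Real.exp (K * (τ - s₀)) * (1 + ‖y‖ ^ 2) with hψ
  have hψpos : ∀ τ y, 0 < ψ τ y := fun τ y => by positivity
  have hψge : ∀ τ, s₀ ≤ τ → ∀ y, 1 + ‖y‖ ^ 2 ≤ ψ τ y := by
    intro τ hτ y
    have : 1 ≤ Real.exp (K * (τ - s₀)) := Real.one_le_exp (by nlinarith)
    have h0 : 0 ≤ 1 + ‖y‖ ^ 2 := by positivity
    nlinarith
  -- the perturbation parameters
  set η : ℝ := q t x - m with hη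
  have hηpos : 0 < η := by linarith
  set ε : ℝ := η / (4 * ψ t x) with hε
  have hεpos : 0 < ε := by positivity
  set δ : ℝ := η / (4 * (s₁ - s₀ + 1)) with hδ
  have hs01 : s₀ ≤ s₁ := ht.1.trans ht.2
  have hδpos : 0 < δ := by rw [hδ]; exact div_pos hηpos (by linarith)
  set Φ : ℝ → (EuclideanSpace ℝ (Fin 3)) → ℝ := fun τ y => q τ y - ε * ψ τ y - δ * (τ - s₀) with hΦ
  have hΦtx : m + η / 2 ≤ Φ t x := by
    have e1 : ε * ψ t x = η / 4 := by rw [hε]; field_simp [(hψpos t x).ne']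
    have e2 : δ * (t - s₀) ≤ η / 4 := by
      rw [hδ, div_mul_eq_mul_div, div_le_iff₀ (by linarith)]
      nlinarith [ht.1, ht.2]
    show m + η / 2 ≤ q t x - ε * ψ t x - δ * (t - s₀)
    linarith
  -- the radius beyond which `Φ < m`
  set R : ℝ := ‖x‖ + 1 + |B - m + 1| / ε with hR
  have hR1 : 1 ≤ R := by
    have : 0 ≤ |B - m + 1| / ε := by positivity
    rw [hR]; nlinarith [norm_nonneg x]
  have hxR : ‖x‖ < R := by
    have : 0 ≤ |B - m + 1| / ε := by positivity
    rw [hR]; linarith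
  have hfar : ∀ τ ∈ Icc s₀ s₁, ∀ y : (EuclideanSpace ℝ (Fin 3)), R ≤ ‖y‖ → Φ τ y ≤ m - 1 := by
    intro τ hτ y hy
    have h1 : ε * R ^ 2 ≥ |B - m + 1| := by
      have hR2 : R ≤ R ^ 2 := by nlinarith
      have : |B - m + 1| / ε ≤ R := by rw [hR]; linarith [norm_nonneg x]
      rw [div_le_iff₀ hεpos] at this
      nlinarith
    have h2 : ε * ψ τ y ≥ ε * (1 + ‖y‖ ^ 2) := mul_le_mul_of_nonneg_left (hψge τ hτ.1 y) hεpos.le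
    have h3 : ‖y‖ ^ 2 ≥ R ^ 2 := by nlinarith [norm_nonneg y]
    have h4 : 0 ≤ δ * (τ - s₀) := mul_nonneg hδpos.le (by linarith [hτ.1])
    have h5 := hB τ hτ y
    have h6 := le_abs_self (B - m + 1)
    show q τ y - ε * ψ τ y - δ * (τ - s₀) ≤ m - 1
    nlinarith
  -- continuity of `Φ` on the compact cylinder and a maximum point
  set S : Set (ℝ × (EuclideanSpace ℝ (Fin 3))) := Icc s₀ s₁ ×ˢ closedBall (0 : (EuclideanSpace ℝ (Fin 3))) R with hS
  have hSc : IsCompact S := isCompact_Icc.prod (isCompact_closedBall _ _)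
  have hSne : S.Nonempty := ⟨(t, x), ht, mem_closedBall_zero_iff.2 hxR.le⟩
  have hΦc : ContinuousOn (uncurry Φ) S := by
    have hq : ContinuousOn (uncurry q) S := hcont.mono (prod_mono Subset.rfl (subset_univ _))
    have hψc : Continuous (uncurry ψ) := by
      show Continuous fun p : ℝ × (EuclideanSpace ℝ (Fin 3)) => Real.exp (K * (p.1 - s₀)) * (1 + ‖p.2‖ ^ 2)
      fun_prop
    have hlin : Continuous fun p : ℝ × (EuclideanSpace ℝ (Fin 3)) => δ * (p.1 - s₀) := by fun_prop
    have : ContinuousOn (fun p : ℝ × (EuclideanSpace ℝ (Fin 3)) => uncurry q p - ε * uncurry ψ p - δ * (p.1 - s₀)) S :=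
      (hq.sub (hψc.continuousOn.const_smul ε |>.congr fun p _ => by simp [smul_eq_mul])).sub hlin.continuousOn
    exact this.congr fun p _ => by simp [hΦ, uncurry]
  obtain ⟨p₁, hp₁S, hmax⟩ := hSc.exists_isMaxOn hSne hΦc
  obtain ⟨t₁, x₁⟩ := p₁
  obtain ⟨ht₁, hx₁⟩ : t₁ ∈ Icc s₀ s₁ ∧ x₁ ∈ closedBall (0 : (EuclideanSpace ℝ (Fin 3))) R := hp₁S
  have hge : Φ t x ≤ Φ t₁ x₁ := hmax (show ((t, x) : ℝ × (EuclideanSpace ℝ (Fin 3))) ∈ S from ⟨ht, mem_closedBall_zero_iff.2 hxR.le⟩)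
  have hΦ₁ : m + η / 2 ≤ Φ t₁ x₁ := hΦtx.trans hge
  -- `t₁ > s₀`
  have ht₁0 : s₀ < t₁ := by
    rcases ht₁.1.eq_or_lt with h | h
    · exfalso
      have h1 : Φ t₁ x₁ ≤ q t₁ x₁ := by
        show q t₁ x₁ - ε * ψ t₁ x₁ - δ * (t₁ - s₀) ≤ q t₁ x₁
        nlinarith [hψpos t₁ x₁, h]
      have h2 : q t₁ x₁ ≤ m := by rw [← h]; exact hinit x₁
      linarith
    · exact h
  -- `‖x₁‖ < R`
  have hx₁R : ‖x₁‖ < R := by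
    by_contra hc
    push Not at hc
    linarith [hfar t₁ ht₁ x₁ hc]
  -- `q(t₁,x₁) > m`
  have hq₁ : m < q t₁ x₁ := by
    have h1 : Φ t₁ x₁ ≤ q t₁ x₁ := by
      show q t₁ x₁ - ε * ψ t₁ x₁ - δ * (t₁ - s₀) ≤ q t₁ x₁
      nlinarith [hψpos t₁ x₁, ht₁.1, hδpos]
    linarith
  obtain ⟨hb, ⟨U, hU, hxU, hqU⟩, ⟨d, hd, hineq⟩⟩ := hsub t₁ ⟨ht₁0, ht₁.2⟩ x₁ hq₁
  -- spatial conditions at the interior maximum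
  have hloc : IsLocalMax (Φ t₁) x₁ := by
    have hball : ball (0 : (EuclideanSpace ℝ (Fin 3))) R ∈ 𝓝 x₁ := isOpen_ball.mem_nhds (mem_ball_zero_iff.2 hx₁R)
    filter_upwards [hball] with y hy
    exact hmax (show ((t₁, y) : ℝ × (EuclideanSpace ℝ (Fin 3))) ∈ S from ⟨ht₁, ball_subset_closedBall hy⟩)
  have hΦC2 : ContDiffOn ℝ 2 (Φ t₁) U := by
    show ContDiffOn ℝ 2 (fun y => q t₁ y - ε * ψ t₁ y - δ * (t₁ - s₀)) U
    exact (hqU.sub (contDiff_const.mul (contDiff_barrier_slice (K * (t₁ - s₀)))).contDiffOn).sub contDiffOn_const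
  have hΔΦ : (Δ (Φ t₁)) x₁ ≤ 0 := laplacian_nonpos_of_isLocalMax_of_contDiffOn hU hxU hΦC2 hloc
  have hqC2 : ContDiffAt ℝ 2 (q t₁) x₁ := hqU.contDiffAt (hU.mem_nhds hxU)
  have hψC2 : ContDiffAt ℝ 2 (fun y => ε * ψ t₁ y) x₁ :=
    (contDiff_const.mul (contDiff_barrier_slice (K * (t₁ - s₀)))).contDiffAt
  have hΔsplit : (Δ (Φ t₁)) x₁ = (Δ (q t₁)) x₁ - ε * (Real.exp (K * (t₁ - s₀)) * 6) := by
    have e1 : Φ t₁ = (q t₁ - fun y => ε * ψ t₁ y) - fun _ => δ * (t₁ - s₀) := by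
      funext y; simp [hΦ]
    have h12 : ContDiffAt ℝ 2 (q t₁ - fun y => ε * ψ t₁ y) x₁ := hqC2.sub hψC2
    rw [e1, ContDiffAt.laplacian_sub h12 contDiffAt_const, ContDiffAt.laplacian_sub hqC2 hψC2]
    have e2 : (fun y => ε * ψ t₁ y) = ε • fun y : (EuclideanSpace ℝ (Fin 3)) => Real.exp (K * (t₁ - s₀)) * (1 + ‖y‖ ^ 2) := by
      funext y; simp [hψ, smul_eq_mul]
    rw [e2, InnerProductSpace.laplacian_smul ε (contDiff_barrier_slice (K * (t₁ - s₀))).contDiffAt,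
      laplacian_barrier_slice]
    simp [InnerProductSpace.laplacian_const, smul_eq_mul]
  have hDΦ : fderiv ℝ (Φ t₁) x₁ = 0 := hloc.fderiv_eq_zero
  have hDq : fderiv ℝ (q t₁) x₁ (b t₁ x₁) = ε * (Real.exp (K * (t₁ - s₀)) * (2 * ⟪x₁, b t₁ x₁⟫_ℝ)) := by
    have hψD := (hasFDerivAt_barrier_slice (K * (t₁ - s₀)) x₁).const_mul ε
    have hqD : HasFDerivAt (q t₁) (fderiv ℝ (q t₁) x₁) x₁ :=
      (hqC2.differentiableAt (by norm_num)).hasFDerivAt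
    have hΦD : HasFDerivAt (Φ t₁) (fderiv ℝ (q t₁) x₁ - ε • (Real.exp (K * (t₁ - s₀)) • ((2 : ℝ) • innerSL ℝ x₁))) x₁ := by
      have h := (hqD.sub hψD).sub_const (δ * (t₁ - s₀))
      exact h.congr_fderiv rfl
    have h0 := hΦD.fderiv
    rw [hDΦ] at h0
    have h1 : fderiv ℝ (q t₁) x₁ = ε • (Real.exp (K * (t₁ - s₀)) • ((2 : ℝ) • innerSL ℝ x₁)) := by
      rw [eq_comm, sub_eq_zero] at h0; exact h0
    rw [h1]
    simp [smul_eq_mul]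
  -- the time condition: `τ ↦ Φ τ x₁` is maximal at `t₁` on `[s₀, t₁]`
  have hψt : HasDerivAt (fun τ => ψ τ x₁) (K * ψ t₁ x₁) t₁ := by
    show HasDerivAt (fun τ => Real.exp (K * (τ - s₀)) * (1 + ‖x₁‖ ^ 2))
      (K * (Real.exp (K * (t₁ - s₀)) * (1 + ‖x₁‖ ^ 2))) t₁
    have h1 : HasDerivAt (fun τ => K * (τ - s₀)) K t₁ := by
      simpa using ((hasDerivAt_id t₁).sub_const s₀).const_mul K
    have h2 := (h1.exp).mul_const (1 + ‖x₁‖ ^ 2)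
    refine h2.congr_deriv ?_
    ring
  have hΦt : HasDerivAt (fun τ => Φ τ x₁) (d - ε * (K * ψ t₁ x₁) - δ) t₁ := by
    have h1 : HasDerivAt (fun τ => δ * (τ - s₀)) δ t₁ := by
      simpa using ((hasDerivAt_id t₁).sub_const s₀).const_mul δ
    exact (hd.sub (hψt.const_mul ε)).sub h1
  have hDt : 0 ≤ d - ε * (K * ψ t₁ x₁) - δ := by
    have e : s₀ + (t₁ - s₀) = t₁ := by ring
    have hΦt' : HasDerivAt (fun τ => Φ τ x₁) (d - ε * (K * ψ t₁ x₁) - δ) (s₀ + (t₁ - s₀)) := by rw [e]; exact hΦt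
    have hsh : HasDerivAt (fun r => Φ (s₀ + r) x₁) (d - ε * (K * ψ t₁ x₁) - δ) (t₁ - s₀) :=
      HasDerivAt.comp_const_add s₀ (t₁ - s₀) hΦt'
    refine Literature.Analysis.PDE.deriv_nonneg_of_isMaxOn_Icc_left (w := fun r => Φ (s₀ + r) x₁)
      (D := d - ε * (K * ψ t₁ x₁) - δ) (t₀ := t₁ - s₀) (s := univ) (by linarith) (subset_univ _)
      hsh.hasDerivWithinAt fun r hr => ?_
    show Φ (s₀ + r) x₁ ≤ Φ (s₀ + (t₁ - s₀)) x₁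
    rw [e]
    exact hmax (show ((s₀ + r, x₁) : ℝ × (EuclideanSpace ℝ (Fin 3))) ∈ S from ⟨⟨by linarith [hr.1], by linarith [hr.2, ht₁.2]⟩, hx₁⟩)
  -- the barrier is a supersolution: `K(1+‖x‖²) − 2Λ‖x‖ − 2n ≥ 0`
  have hbar : 0 ≤ K * (1 + ‖x₁‖ ^ 2) - 2 * Λ * ‖x₁‖ - 6 := by
    have hN := norm_nonneg x₁
    have h1 : 0 ≤ 1 + ‖x₁‖ ^ 2 - ‖x₁‖ := by nlinarith [sq_nonneg (‖x₁‖ - 1)]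
    have e : K * (1 + ‖x₁‖ ^ 2) - 2 * Λ * ‖x₁‖ - 6 = 2 * Λ * (1 + ‖x₁‖ ^ 2 - ‖x₁‖) + 6 * ‖x₁‖ ^ 2 := by
      rw [hK]; ring
    rw [e]
    exact add_nonneg (mul_nonneg (by positivity) h1) (by positivity)
  have hinner : -(‖x₁‖ * Λ) ≤ ⟪x₁, b t₁ x₁⟫_ℝ := by
    have h1 := real_inner_le_norm x₁ (b t₁ x₁)
    have h2 := abs_real_inner_le_norm x₁ (b t₁ x₁)
    have h3 : ‖x₁‖ * ‖b t₁ x₁‖ ≤ ‖x₁‖ * Λ := mul_le_mul_of_nonneg_left hb (norm_nonneg _)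
    have := neg_abs_le ⟪x₁, b t₁ x₁⟫_ℝ
    linarith
  -- combine: `d + Dq[b] − Δq ≥ δ + ε e^{K(t₁−s₀)} (K(1+‖x₁‖²) − 2Λ‖x₁‖ − 2n) > 0`
  obtain ⟨P, hP⟩ : ∃ P : ℝ, P = ε * Real.exp (K * (t₁ - s₀)) := ⟨_, rfl⟩
  have hP0 : 0 ≤ P := by rw [hP]; positivity
  have hψval : ψ t₁ x₁ = Real.exp (K * (t₁ - s₀)) * (1 + ‖x₁‖ ^ 2) := rfl
  rw [hψval] at hDt
  have e1 : ε * (K * (Real.exp (K * (t₁ - s₀)) * (1 + ‖x₁‖ ^ 2))) = K * P * (1 + ‖x₁‖ ^ 2) := by rw [hP]; ring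
  have F1 : K * P * (1 + ‖x₁‖ ^ 2) + δ ≤ d := by linarith [hDt, e1.le, e1.ge]
  have e2 : ε * (Real.exp (K * (t₁ - s₀)) * (2 * ⟪x₁, b t₁ x₁⟫_ℝ)) = 2 * P * ⟪x₁, b t₁ x₁⟫_ℝ := by rw [hP]; ring
  have e3 : ε * (Real.exp (K * (t₁ - s₀)) * 6) = 6 * P := by rw [hP]; ring
  rw [hDq, e2] at hineq
  have F3 : (Δ (q t₁)) x₁ ≤ 6 * P := by rw [hΔsplit, e3] at hΔΦ; linarith
  have F4 : -(2 * P * (‖x₁‖ * Λ)) ≤ 2 * P * ⟪x₁, b t₁ x₁⟫_ℝ := by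
    have h := mul_le_mul_of_nonneg_left hinner (by positivity : (0 : ℝ) ≤ 2 * P)
    rwa [mul_neg] at h
  have F5 : 0 ≤ K * P * (1 + ‖x₁‖ ^ 2) - 2 * P * (‖x₁‖ * Λ) - 6 * P := by
    have h := mul_nonneg hP0 hbar
    have e5 : P * (K * (1 + ‖x₁‖ ^ 2) - 2 * Λ * ‖x₁‖ - 6) =
        K * P * (1 + ‖x₁‖ ^ 2) - 2 * P * (‖x₁‖ * Λ) - 6 * P := by ring
    linarith [h, e5.le, e5.ge]
  linarith [F1, F3, F4, F5, hineq, hδpos]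

end Summit.NavierStokesRegularity.NavierStokesRegularity.Theorems.HalfSpaceWindowDoorCirculationCarryingRigidityWholeSpaceMaxPrinciple

end
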